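import Literature.AlgebraicGeometry.Frobenioids.BaseSectionsOfObjectsCor57bProofs
import Literature.AlgebraicGeometry.Frobenioids.BaseSectionsOfObjectsCor57FSMHolds
import Literature.AlgebraicGeometry.Frobenioids.BaseSectionsOfObjectsCor57iModelBirat
import Literature.AlgebraicGeometry.Frobenioids.EquivalencePreStepsFSMFF2008Assembly
import Literature.AlgebraicGeometry.Frobenioids.Cor411iiOfThm34ii
import HarnessLib

/-!
# Frobenioids I, Corollary 5.7 (i) [base-sections, quasi-base-Frobenius pairs, pre-model clause] and (ii)
# AS TYPED, for EVERY equivalence of Frobenioids — exact-name `_holds` witnesses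

Mochizuki, *The geometry of Frobenioids I: the general theory*, Kyushu J. Math. **62** (2008)
293–400, Cor. 5.7 (i), (ii) pp. 107–108, proof p. 108 ll. 15–21: "sorting through the definitions, to verify
assertions (i), (ii), (iii), (iv) it suffices to show that `Ψ` preserves isotropic objects, prime-Frobenius
morphisms, pull-back morphisms, birationalizations, the natural projection functor `C_i → D_i` [hence, in
particular, the units `O^×(−)`], and … Frobenius degrees. But this follows from Theorem 3.4, (i), (iii);
Corollary 4.10; Corollary 4.11, (ii)." [cite: MochizukiFrdI2008, Cor. 5.7 p.107]

PROOF-ONLY companion of `BaseSectionsOfObjects.lean` (statements, seat abc-iut-L1-t5), abc-iut cell, F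
fact-proving wave, seat abc-iut-f-022 (FACT-LIST rows F-0937 `PreFrobenioid.Cor57i_sections`, F-0936
`PreFrobenioid.Cor57i_pairs`, F-0938 `PreFrobenioid.Cor57ii`; pre-model conjunct of F-0935 `PreFrobenioid.Cor57i_model`).
The tree holds seat abc-iut-L1-d6's proofs of the typed Cor. 5.7 (i)/(ii) modulo the typed per-instance
conclusions of [FrdI] Thm. 3.4 (iii) and Cor. 4.11 (ii) for `Ψ` (`cor57i_sections_of`, `cor57i_pairs_of`,
`isOfPreModelType_iff_of`, `cor57ii_of_cor411ii`, file `BaseSectionsOfObjectsCor57Proofs.lean`). Both inputs are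
now theorems of the tree in print's generality — every pair of Frobenioids `C_i → F_{Φ_i}`, every equivalence
`Ψ`, the base categories entering only through "standard type" (d) (bases of FSMFF-type, 2008 wording):
* Thm. 3.4 (iii): the 0-ary named fact `FrdI.Thm34iii` is PROVED (`FrdI.Thm34iii_holds`, seat abc-iut-L1-t11,
  `EquivalencePreStepsFSMFF2008Assembly.lean`, over seat abc-iut-L1-t13's `EquivalencePreStepsFSMFF2008.lean`);
* Cor. 4.11 (ii): the typed per-instance statement for Frobenioids with `Φ_i` perf-factorial follows from the
  Thm. 3.4 (ii) conclusions for `Ψ`, `Ψ⁻¹` (seat abc-iut-L1-d6's `PreFrobenioid.cor411ii_ofFunctor_of_thm34ii`,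
  `Cor411iiOfThm34ii.lean`, apex of the cell sub-DAG `plan/L1/SUBDAG-FrdI-Cor411.md`), and those conclusions
  are `FrdI.thm34ii_ofFunctor` (seat abc-iut-L1-t11).
Since the standing hypotheses `Cor57Hypotheses` of the typed Cor. 5.7 contain "`C_i` is a Frobenioid" and
"`Φ_i` is perf-factorial", this file is the composition: the typed `Cor57i_sections`, `Cor57i_pairs`, `Cor57ii`
hold for ALL their binders (exact-name witnesses `Cor57i_sections_holds`, `Cor57i_pairs_holds`, `Cor57ii_holds`,
fully-qualified closed types), and the pre-model conjunct of `Cor57i_model` ("`C₁` is of model type iff `C₂` is",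
pre-model half) holds for all its binders (`cor57i_model_isOfPreModelType_iff`), and the WHOLE typed
`Cor57i_model` holds at its faithful instance — both birationalization data THE birationalizations
`PreFrobenioid.biratData` — for every `Ψ` (`cor57i_model_biratData_holds`, over this seat's
`cor57i_model_biratData_of`, `BaseSectionsOfObjectsCor57iModelBirat.lean`); the Def. 4.5 (i) conjunct over FREE
data is a schema whose universal closure is refuted in `BaseSectionsOfObjectsCor57iModelSchema.lean`.

Nothing here is specific to the abc programme; no statement of the paper is restated or strengthened; no new
definition; nothing bears on, or takes a side on, [IUTchIII] Cor. 3.12.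
-/

namespace Literature.AlgebraicGeometry.Frobenioids

open CategoryTheory Opposite

universe w v v' u u'

namespace PreFrobenioid

section Cor57Holds

variable {D₁ : Type u} [Category.{v} D₁] {Φ₁ : D₁ᵒᵖ ⥤ CommMonCat.{w}}
  {C₁ : Type u'} [Category.{v'} C₁] (F₁ : C₁ ⥤ ElemFrobenioid Φ₁)
  {D₂ : Type u} [Category.{v} D₂] {Φ₂ : D₂ᵒᵖ ⥤ CommMonCat.{w}}
  {C₂ : Type u'} [Category.{v'} C₂] (F₂ : C₂ ⥤ ElemFrobenioid Φ₂)

/-! ### The two inputs of the printed proof, from the hypotheses of Cor. 5.7 alone -/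

/-- **"Theorem 3.4, (iii)"** (p. 108 l. 21) under the hypotheses of Cor. 5.7: the typed per-instance
[FrdI] Thm. 3.4 (iii) for `Ψ` — the proved 0-ary fact `FrdI.Thm34iii` (seat abc-iut-L1-t11's
`FrdI.Thm34iii_holds`) at the two Frobenioids. [cite: MochizukiFrdI2008, Thm. 3.4 (iii) p.62] -/
theorem Cor57Hypotheses.thm34iii {Ψ : C₁ ≌ C₂} (hyp : Cor57Hypotheses F₁ F₂ Ψ) :
    (PreFrobenioidData.ofFunctor Φ₁ F₁).Thm34iii (PreFrobenioidData.ofFunctor Φ₂ F₂) Ψ :=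
  FrdI.Thm34iii_holds F₁ F₂ hyp.isFrobenioid₁ hyp.isFrobenioid₂ Ψ

/-- **"Corollary 4.11, (ii)"** (p. 108 l. 21) under the hypotheses of Cor. 5.7: the typed per-instance
[FrdI] Cor. 4.11 (ii) for `Ψ` — `C_i` Frobenioids with `Φ_i` perf-factorial (fields of `Cor57Hypotheses`), the
Thm. 3.4 (ii) conclusions for `Ψ`, `Ψ⁻¹` by `FrdI.thm34ii_ofFunctor` (seat abc-iut-L1-t11), then seat
abc-iut-L1-d6's `cor411ii_ofFunctor_of_thm34ii`. [cite: MochizukiFrdI2008, Cor. 4.11 (ii) p.91] -/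
theorem Cor57Hypotheses.cor411ii {Ψ : C₁ ≌ C₂} (hyp : Cor57Hypotheses F₁ F₂ Ψ) :
    (PreFrobenioidData.ofFunctor Φ₁ F₁).Cor411ii (PreFrobenioidData.ofFunctor Φ₂ F₂) Ψ :=
  cor411ii_ofFunctor_of_thm34ii hyp.isFrobenioid₁ hyp.isFrobenioid₂ Ψ hyp.perfFactorial₁ hyp.perfFactorial₂
    (FrdI.thm34ii_ofFunctor hyp.isFrobenioid₁ hyp.isFrobenioid₂ Ψ)
    (FrdI.thm34ii_ofFunctor hyp.isFrobenioid₂ hyp.isFrobenioid₁ Ψ.symm)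

variable (Ψ : C₁ ≌ C₂)

/-! ### Cor. 5.7 (i), (ii) as typed, no residual hypothesis -/

/-- **[FrdI] Cor. 5.7 (i), base-sections, AS TYPED**: "`Ψ` maps base-sections … of `C₁` to base-sections … of
`C₂`" — for every equivalence `Ψ` of Frobenioids under the standing hypotheses of Cor. 5.7 (seat abc-iut-L1-d6's
`cor57i_sections_of` with both inputs supplied). [cite: MochizukiFrdI2008, Cor. 5.7 (i) p.107] -/
theorem cor57i_sections_holds : Cor57i_sections F₁ F₂ Ψ := fun hyp =>
  cor57i_sections_of F₁ F₂ Ψ (hyp.thm34iii F₁ F₂) (hyp.cor411ii F₁ F₂) hyp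

/-- **[FrdI] Cor. 5.7 (i), quasi-base-Frobenius pairs, AS TYPED**: "`Ψ` maps … quasi-base-Frobenius pairs of
`C₁` to … quasi-base-Frobenius pairs of `C₂`" (the Frobenius-sections matching up to the automorphism
`Ψ^{N_{≥1}}` of `N_{≥1}` of Thm. 3.4 (iii)). [cite: MochizukiFrdI2008, Cor. 5.7 (i) p.107] -/
theorem cor57i_pairs_holds : Cor57i_pairs F₁ F₂ Ψ := fun hyp =>
  cor57i_pairs_of F₁ F₂ Ψ (hyp.thm34iii F₁ F₂) (hyp.cor411ii F₁ F₂) hyp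

/-- **[FrdI] Cor. 5.7 (i), "In particular, `C₁` is of model type if and only if `C₂` is" — pre-model half
(Def. 2.7 (iii)), AS TYPED** (the first conjunct of `Cor57i_model`, for `Ψ` and `Ψ⁻¹`).
[cite: MochizukiFrdI2008, Cor. 5.7 (i) p.108] -/
theorem cor57i_model_isOfPreModelType_iff (hyp : Cor57Hypotheses F₁ F₂ Ψ) :
    IsOfPreModelType F₁ ↔ IsOfPreModelType F₂ :=
  isOfPreModelType_iff_of F₁ F₂ Ψ (hyp.thm34iii F₁ F₂) (hyp.cor411ii F₁ F₂)
    ((hyp.symm F₁ F₂).thm34iii F₂ F₁) ((hyp.symm F₁ F₂).cor411ii F₂ F₁) hyp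

/-- **[FrdI] Cor. 5.7 (i), "`C₁` is of model type if and only if `C₂` is" — BOTH halves (Def. 2.7 (iii)
pre-model AND Def. 4.5 (i) birationally Frobenius-normalized), AT THE birationalizations, no residual
hypothesis**: the typed `Cor57i_model F₁ F₂ Ψ (biratData hF₁ hsq₁) (biratData hF₂ hsq₂)` — the faithful instance
of FACT-LIST row F-0935 — for every equivalence `Ψ` of Frobenioids (this seat's `cor57i_model_biratData_of`
with its Thm. 3.4 (ii)/(iii) and Cor. 4.11 (ii) inputs supplied). [cite: MochizukiFrdI2008, Cor. 5.7 (i) p.108] -/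
theorem cor57i_model_biratData_holds (hF₁ : IsFrobenioid F₁) (hF₂ : IsFrobenioid F₂)
    (hsq₁ : HasBiratSquares F₁) (hsq₂ : HasBiratSquares F₂) :
    Cor57i_model F₁ F₂ Ψ (biratData hF₁ hsq₁) (biratData hF₂ hsq₂) := fun hyp =>
  cor57i_model_biratData_of F₁ F₂ hF₁ hF₂ hsq₁ hsq₂ Ψ (FrdI.thm34ii_ofFunctor hF₁ hF₂ Ψ)
    (FrdI.thm34ii_ofFunctor hF₂ hF₁ Ψ.symm) (hyp.thm34iii F₁ F₂) ((hyp.symm F₁ F₂).thm34iii F₂ F₁)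
    (hyp.cor411ii F₁ F₂) ((hyp.symm F₁ F₂).cor411ii F₂ F₁) hyp

/-- The same at the CANONICAL birationalizations of the two Frobenioids (composition squares
`hasBiratSquares_of_isFrobenioid`). [cite: MochizukiFrdI2008, Cor. 5.7 (i) p.108] -/
theorem cor57i_model_biratData_holds' (hF₁ : IsFrobenioid F₁) (hF₂ : IsFrobenioid F₂) :
    Cor57i_model F₁ F₂ Ψ (biratData hF₁ (hasBiratSquares_of_isFrobenioid hF₁))
      (biratData hF₂ (hasBiratSquares_of_isFrobenioid hF₂)) :=
  cor57i_model_biratData_holds F₁ F₂ Ψ hF₁ hF₂ _ _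

/-- **[FrdI] Cor. 5.7 (ii) AS TYPED**: "`C₁` is of unit-profinite type if and only if `C₂` is" — for every
equivalence `Ψ` of Frobenioids under the standing hypotheses of Cor. 5.7 (seat abc-iut-L1-d6's
`cor57ii_of_cor411ii` with its Cor. 4.11 (ii) input supplied). [cite: MochizukiFrdI2008, Cor. 5.7 (ii) p.108] -/
theorem cor57ii_holds : Cor57ii F₁ F₂ Ψ := fun hyp => cor57ii_of_cor411ii F₁ F₂ Ψ (hyp.cor411ii F₁ F₂) hyp

end Cor57Holds

/-! ### Exact-name closed witnesses (FACT-LIST rows F-0937, F-0936, F-0938; rule R7, fully-qualified types) -/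

/-- FACT-LIST F-0937: [FrdI] Cor. 5.7 (i), base-sections; exact-name CLOSED witness of the universal closure of
`PreFrobenioid.Cor57i_sections` (proof = `cor57i_sections_holds`). [cite: MochizukiFrdI2008, Cor. 5.7 (i) p.108] -/
theorem Cor57i_sections_holds :
    ∀ {D₁ : Type u} [Category.{v} D₁] {Φ₁ : D₁ᵒᵖ ⥤ CommMonCat.{w}} {C₁ : Type u'} [Category.{v'} C₁]
      (F₁ : C₁ ⥤ ElemFrobenioid Φ₁)
      {D₂ : Type u} [Category.{v} D₂] {Φ₂ : D₂ᵒᵖ ⥤ CommMonCat.{w}} {C₂ : Type u'} [Category.{v'} C₂]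
      (F₂ : C₂ ⥤ ElemFrobenioid Φ₂) (Ψ : C₁ ≌ C₂),
      Literature.AlgebraicGeometry.Frobenioids.PreFrobenioid.Cor57i_sections F₁ F₂ Ψ := by
  intro _ _ _ _ _ F₁ _ _ _ _ _ F₂ Ψ
  exact cor57i_sections_holds F₁ F₂ Ψ

/-- FACT-LIST F-0936: [FrdI] Cor. 5.7 (i), quasi-base-Frobenius pairs; exact-name CLOSED witness of the
universal closure of `PreFrobenioid.Cor57i_pairs` (proof = `cor57i_pairs_holds`).
[cite: MochizukiFrdI2008, Cor. 5.7 (i) p.108] -/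
theorem Cor57i_pairs_holds :
    ∀ {D₁ : Type u} [Category.{v} D₁] {Φ₁ : D₁ᵒᵖ ⥤ CommMonCat.{w}} {C₁ : Type u'} [Category.{v'} C₁]
      (F₁ : C₁ ⥤ ElemFrobenioid Φ₁)
      {D₂ : Type u} [Category.{v} D₂] {Φ₂ : D₂ᵒᵖ ⥤ CommMonCat.{w}} {C₂ : Type u'} [Category.{v'} C₂]
      (F₂ : C₂ ⥤ ElemFrobenioid Φ₂) (Ψ : C₁ ≌ C₂),
      Literature.AlgebraicGeometry.Frobenioids.PreFrobenioid.Cor57i_pairs F₁ F₂ Ψ := by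
  intro _ _ _ _ _ F₁ _ _ _ _ _ F₂ Ψ
  exact cor57i_pairs_holds F₁ F₂ Ψ

/-- FACT-LIST F-0938: [FrdI] Cor. 5.7 (ii) ("`C₁` is of unit-profinite type iff `C₂` is"); exact-name CLOSED
witness of the universal closure of `PreFrobenioid.Cor57ii` (proof = `cor57ii_holds`).
[cite: MochizukiFrdI2008, Cor. 5.7 (ii) p.108] -/
theorem Cor57ii_holds :
    ∀ {D₁ : Type u} [Category.{v} D₁] {Φ₁ : D₁ᵒᵖ ⥤ CommMonCat.{w}} {C₁ : Type u'} [Category.{v'} C₁]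
      (F₁ : C₁ ⥤ ElemFrobenioid Φ₁)
      {D₂ : Type u} [Category.{v} D₂] {Φ₂ : D₂ᵒᵖ ⥤ CommMonCat.{w}} {C₂ : Type u'} [Category.{v'} C₂]
      (F₂ : C₂ ⥤ ElemFrobenioid Φ₂) (Ψ : C₁ ≌ C₂),
      Literature.AlgebraicGeometry.Frobenioids.PreFrobenioid.Cor57ii F₁ F₂ Ψ := by
  intro _ _ _ _ _ F₁ _ _ _ _ _ F₂ Ψ
  exact cor57ii_holds F₁ F₂ Ψ

end PreFrobenioid

end Literature.AlgebraicGeometry.Frobenioids
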